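import Literature.AlgebraicGeometry.HodgeTheory.HodgeGenericQbarDescentFiniteMonodromyInputs
import Literature.AlgebraicGeometry.HodgeTheory.DirectImageBaseChangeContinuous
import Literature.AlgebraicGeometry.Motives.ComplexPointsFiniteEtaleCovering
import Literature.AlgebraicGeometry.FundamentalGroup.RiemannExistenceQbarDescentProofs
import Summits.HodgeConjecture.HodgeConjecture.Theorems.LinearSystemTorelliMiddleDivisorSupportFourfoldStubFiniteMonodromyOfTypeStability
import Summits.HodgeConjecture.HodgeConjecture.Theses.LinearSystemTorelli
import HarnessLib

/-!
# Route `LinearSystemTorelli` — crux `MiddleDivisorSupportFourfold` (stmt-HodgeConjecture-2409), line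
`IdeatorFiveSketch`: finite monodromy ⟹ type stability (tightness of the v10 reshape A ↦ A')

Helper file for the crux item stmt-HodgeConjecture-2409 (`--supports`; it closes nothing). Since
skeleton v10 (lead c10) the line's transcendence kernel is the registered stub A'
`stub_typeStabilityAtQbarGeneric` (T): at a point `s` over the generic point of the smooth
irreducible `ℚ̄`-base of a smooth projective `ℚ̄`-family of fourfolds, every continuation of a
rational `(2,2)`-class `α ∈ H⁴(𝒳_s)` along a loop at `s` is again of type `(2,2)`. The old stub A
(finite monodromy orbit of `α`) is derived from T UNCONDITIONALLY
(`stub_finiteMonodromyAtGenericSpread_of_typeStabilityAtQbarGeneric`, p127337: a type-stable rational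
class has finite orbit, by Hodge–Riemann for the relative hyperplane class). This file proves the
CONVERSE modulo the line's own two classical debts, so that the kernel record now says

> at every complex point of the complexification of a smooth projective `ℚ̄`-family over a smooth
> irreducible quasi-projective base, for a rational `(p,p)`-class `α`:
> (finite monodromy orbit) ↔ (every loop-continuation of `α` is of type `(p,p)`),
> granted Riemann's existence theorem with `ℚ̄`-descent (`FundamentalGroup.riemannExistence_qbarDescent_of_finiteIndex`,
> itself ⟸ the covering form `riemannExistence_finiteCovering` = stub C1, p126127) and Deligne's
> théorème de la partie fixe (`deligne_globalInvariantCycles` = route crux stmt-16363 = stub D).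

Proof of → (Voisin 2007 §3 / Charles–Schnell Thm. 11.3.19, read for the conjugates instead of for
`α`): finite orbit ⟹ finite-index stabiliser `H`; the finite étale cover `g : S' → S` attached to
`H` (Riemann existence), a point `s'` over `s`; on the pulled-back family `f'` the class `e^* α` is
monodromy invariant, hence the value at `s'` of a continuous global section, hence (partie fixe +
Hodge lift, polarisability PROVED in the tree) the restriction of a rational `(p,p)`-class `β` on a
smooth projective compactification `X̄ ⊇ 𝒳 ×_S S'` (Hironaka, PROVED in the tree). Now let `β₁` be a
continuation of `α` along a loop `γ` at `s`. Lift `γ` to a path `γ'` in `S'(ℂ)` from `s'` to some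
`s''` (`g(ℂ)` is a covering map: finite étale, `isCoveringMap_map_of_isFinite`). Upstairs, the
restrictions of the global class `i^* β` to `X'_{s'}` and `X'_{s''}` are continuations of each other
along `γ'` (`isContinuationAlong_globalSection`); pushing this continuation down along the base
change (`IsContinuationAlong.baseChange`, transfer along the fibre isomorphisms) gives a continuation
of `α` along `γ = g ∘ γ'` ending at the transfer of `β|_{X'_{s''}}`; continuations along a given path
are unique (`isContinuationAlong_iff_transportFun_eq`), so `β₁` is that transfer, and `β|_{X'_{s''}}`
is of type `(p,p)` as the pull-back of `β` along the algebraic map `X'_{s''} ⟶ X̄`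
(`IsOfHodgeType.map_of_independent`, `hodgePQ_independent_of_hodgeModel_holds`), a type preserved by
the fibre isomorphism.

* `linearSystemTorelli_isOfHodgeType_of_isContinuationAlong_of_finite` — finite orbit ⟹ every
  loop-continuation is `(p,p)`, modulo the two named facts (any point `s`, any `(n,p)`);
* `linearSystemTorelli_finite_setOf_isContinuationAlong_iff_forall_isOfHodgeType` — the pointwise
  `↔` (← is p127337's unconditional lemma);
* `linearSystemTorelli_typeStabilityAtQbarGeneric_of_forall_finite` — the registered stub A'
  (signature verbatim) ⟸ stub C1 (`riemannExistence_finiteCovering`) + stub D (the route decl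
  `Theses.LinearSystemTorelli.DeligneGlobalInvariantCycles`) + the ∀-form of finite monodromy at
  `ℚ̄`-generic points. With p127337 this certifies that inside the line (i.e. modulo C1 and D) the
  reshape v9 → v10 (A ↦ A') changed nothing: T is exactly "finite monodromy of rational
  `(2,2)`-classes at `ℚ̄`-generic points of `ℚ̄`-families of fourfolds".
-/

-- every declaration of this problem lives in `Summit.HodgeConjecture.HodgeConjecture.…`
set_option linter.dupNamespace false

noncomputable section

namespace Summit.HodgeConjecture.HodgeConjecture.Theorems

open CategoryTheory CategoryTheory.Limits AlgebraicGeometry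
open _root_.Topology
open Literature.AlgebraicGeometry Literature.AlgebraicGeometry.Motives
open Literature.AlgebraicGeometry.HodgeTheory
open Literature.AlgebraicTopology.SingularHomology

/-- **Uniqueness of continuations, across a re-typing of the endpoint.** If `Rᵏ π_* ℂ` is a local
system on `S(ℂ)` and `q₁ : s₀ ⇝ t₁`, `q₂ : s₀ ⇝ t₂` are the SAME map `[0,1] → S(ℂ)` (so `t₁ = t₂`,
but possibly not syntactically), then continuations `β₁`, `β₂` of one class `α` along `q₁`, `q₂`
define the same fibre class `(t₁, β₁) = (t₂, β₂)` — lifts to the covering space of fibre classes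
are unique (`isContinuationAlong_iff_transportFun_eq`). [cite: HatcherAT2002, §1.3 Prop. 1.34]
[cite: VoisinHodgeI2002, §9.2.1] -/
theorem linearSystemTorelli_fiberClass_eq_of_isContinuationAlong_of_coe_eq
    {𝒳 S : SchemeOver ℂ} {π : 𝒳 ⟶ S} {k : ℕ}
    (hU : IsCohomologicallyLocallyTrivialOn π (Set.univ : Set (ComplexPoints S)))
    {s₀ t₁ t₂ : ComplexPoints S} (q₁ : Path s₀ t₁) (q₂ : Path s₀ t₂)
    (hq : (q₁ : unitInterval → ComplexPoints S) = q₂)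
    {α : complexBetti (fiberOver π s₀) k} {β₁ : complexBetti (fiberOver π t₁) k}
    {β₂ : complexBetti (fiberOver π t₂) k}
    (h₁ : IsContinuationAlong q₁ α β₁) (h₂ : IsContinuationAlong q₂ α β₂) :
    (⟨t₁, β₁⟩ : FiberClass π k) = ⟨t₂, β₂⟩ := by
  have ht : t₁ = t₂ := q₁.target.symm.trans ((congrFun hq 1).trans q₂.target)
  subst ht
  obtain rfl : q₁ = q₂ := Path.ext hq
  rw [FiberClass.mk_eq_mk_iff, ← (isContinuationAlong_iff_transportFun_eq π k hU q₁ α β₁).1 h₁,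
    ← (isContinuationAlong_iff_transportFun_eq π k hU q₁ α β₂).1 h₂]

/-- **Finite monodromy ⟹ type stability, modulo Riemann existence (with `ℚ̄`-descent) and the
global invariant cycle theorem.** For `σ : ℚ̄ →+* ℂ`, a `ℚ̄`-morphism `f₀ : 𝒳₀ ⟶ S₀` of
quasi-projective `ℚ̄`-schemes with `S₀` smooth irreducible whose complexification is a smooth
projective family of relative dimension `n`, ANY complex point `s` of `S₀ ⊗_σ ℂ` and a rational
class `α ∈ H²ᵖ(𝒳_s)` of type `(p,p)` with FINITE monodromy orbit, every flat continuation `β₁` of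
`α` along a loop at `s` is of type `(p,p)`: `β₁` is the transfer, along the fibre isomorphism, of
the restriction to another fibre over `s` of one rational `(p,p)`-class on a smooth projective
compactification of the pulled-back family over the finite étale cover killing the monodromy of
`α` (Voisin 2007 §3; Charles–Schnell Thm. 11.3.19), and pull-backs along morphisms of smooth
projective varieties preserve Hodge types. Inputs: the named facts
`FundamentalGroup.riemannExistence_qbarDescent_of_finiteIndex` (SGA1 XII 5.1 + XIII 4.6; ⟸ the
covering form `riemannExistence_finiteCovering`, p126127) and `deligne_globalInvariantCycles`
(Hodge II 4.1.1). [cite: Voisin2007HodgeLoci, §3, proof of Prop. 0.7]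
[cite: CharlesSchnell2014Notes, Thm. 11.3.19 (proof)] [cite: DeligneHodgeII1971, Théorème 4.1.1]
[cite: SGA1, Exp. XII Thm. 5.1] [cite: VoisinHodgeII2003, §3.1.2] -/
theorem linearSystemTorelli_isOfHodgeType_of_isContinuationAlong_of_finite
    (hRE : Literature.AlgebraicGeometry.FundamentalGroup.riemannExistence_qbarDescent_of_finiteIndex)
    (hD : deligne_globalInvariantCycles)
    (σ : AlgebraicClosure ℚ →+* ℂ) ⦃𝒳₀ S₀ : SchemeOver (AlgebraicClosure ℚ)⦄ (f₀ : 𝒳₀ ⟶ S₀)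
    (n p : ℕ) (h𝒳₀ : IsQuasiProjectiveOver 𝒳₀) (hS₀ : IsQuasiProjectiveOver S₀)
    (hirr : IrreducibleSpace S₀.left) (hsm : AlgebraicGeometry.Smooth S₀.hom)
    (hf : IsSmoothProjectiveFamily ((baseChangeHom σ).map f₀) n)
    (s : ComplexPoints ((baseChangeHom σ).obj S₀))
    (α : complexBetti (fiberOver ((baseChangeHom σ).map f₀) s) (2 * p)) (hαr : IsRationalClass α)
    (hαh : IsOfHodgeType n (fiberOver ((baseChangeHom σ).map f₀) s) (2 * p) p p α)
    (hfin : {β : complexBetti (fiberOver ((baseChangeHom σ).map f₀) s) (2 * p) |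
      ∃ γ : Path s s, IsContinuationAlong γ α β}.Finite)
    (γ : Path s s) (β₁ : complexBetti (fiberOver ((baseChangeHom σ).map f₀) s) (2 * p))
    (hβ₁ : IsContinuationAlong γ α β₁) :
    IsOfHodgeType n (fiberOver ((baseChangeHom σ).map f₀) s) (2 * p) p p β₁ := by
  haveI := hirr
  -- Step 1 (the orbit): finite orbit ⟹ a finite-index subgroup `H ≤ π₁(S(ℂ), s)` fixes `α`
  obtain ⟨hU, H, hHfi, hHfix⟩ :=
    exists_finiteIndex_of_finite_setOf_isContinuationAlong_of_qbarFamily σ f₀ (2 * p) hS₀ hsm hf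
      s α hfin
  -- Step 2 (the finite étale cover `S' → S`, defined over `ℚ̄`): Riemann existence + descent
  obtain ⟨S₀', g₀, s', hs, hS₀'qp, hS'irr, hg₀, hg₀fin, hloops⟩ := hRE σ S₀ hS₀ hirr hsm s H hHfi
  subst hs
  -- Step 3: the bases `S = S₀ ⊗ ℂ`, `S' = S₀' ⊗ ℂ` are smooth of the same pure dimension `d`,
  -- quasi-projective; `S'(ℂ)` is a connected manifold; `g(ℂ)` is a local homeomorphism and a
  -- covering map
  haveI := hsm
  obtain ⟨d, hd⟩ := Motives.exists_smoothOfRelativeDimension_of_smooth S₀.hom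
  haveI := hd
  haveI hSd : SmoothOfRelativeDimension d ((baseChangeHom σ).obj S₀).hom :=
    smoothOfRelativeDimension_baseChangeHom_hom σ d S₀
  have hSqp : IsQuasiProjectiveOver ((baseChangeHom σ).obj S₀) := hS₀.baseChangeHom σ
  have hS'qp : IsQuasiProjectiveOver ((baseChangeHom σ).obj S₀') := hS₀'qp.baseChangeHom σ
  haveI : LocallyOfFiniteType ((baseChangeHom σ).obj S₀).hom := hSqp.locallyOfFiniteType
  haveI : LocallyOfFiniteType ((baseChangeHom σ).obj S₀').hom := hS'qp.locallyOfFiniteType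
  haveI : IsSeparated ((baseChangeHom σ).obj S₀).hom := hSqp.isVarietyPair_ofScheme.isSeparated
  haveI : IsSeparated ((baseChangeHom σ).obj S₀').hom := hS'qp.isVarietyPair_ofScheme.isSeparated
  haveI := hg₀
  haveI := hg₀fin
  haveI hg0 : SmoothOfRelativeDimension 0 ((baseChangeHom σ).map g₀).left := by
    letI := σ.toAlgebra
    have := smoothOfRelativeDimension_isStableUnderBaseChange 0
    exact MorphismProperty.of_isPullback (P := @SmoothOfRelativeDimension 0)
      (Motives.isPullback_baseChange_map_left ℂ g₀).flip inferInstance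
  haveI : AlgebraicGeometry.Smooth ((baseChangeHom σ).map g₀).left :=
    SmoothOfRelativeDimension.smooth 0 _
  haveI hgfin : IsFinite ((baseChangeHom σ).map g₀).left := by
    letI := σ.toAlgebra
    exact MorphismProperty.of_isPullback (P := @IsFinite)
      (Motives.isPullback_baseChange_map_left ℂ g₀).flip inferInstance
  haveI hS'd : SmoothOfRelativeDimension d ((baseChangeHom σ).obj S₀').hom := by
    have h : SmoothOfRelativeDimension (0 + d)
        (((baseChangeHom σ).map g₀).left ≫ ((baseChangeHom σ).obj S₀).hom) :=
      inferInstance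
    rw [Over.w] at h
    simpa using h
  haveI : IrreducibleSpace ((baseChangeHom σ).obj S₀').left := hS'irr
  haveI : ConnectedSpace (ComplexPoints ((baseChangeHom σ).obj S₀')) :=
    (Motives.ComplexPoints.connectedSpace_iff_holds _).2 inferInstance
  haveI : PathConnectedSpace (ComplexPoints ((baseChangeHom σ).obj S₀')) :=
    pathConnectedSpace_complexPoints_of_smoothOfRelativeDimension _ d
  letI := Motives.ComplexPoints.chartedSpace ((baseChangeHom σ).obj S₀') d
  haveI : LocallyPathConnectedSpace (ComplexPoints ((baseChangeHom σ).obj S₀')) :=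
    ChartedSpace.locallyPathConnectedSpace (EuclideanSpace ℝ (Fin (2 * d))) _
  have hgloc : IsLocalHomeomorph (AlgPoints.map ((baseChangeHom σ).map g₀) :
      ComplexPoints ((baseChangeHom σ).obj S₀') → ComplexPoints ((baseChangeHom σ).obj S₀)) :=
    Motives.ComplexPoints.isLocalHomeomorph_map d _
  have hcov : IsCoveringMap (AlgPoints.map ((baseChangeHom σ).map g₀) :
      ComplexPoints ((baseChangeHom σ).obj S₀') → ComplexPoints ((baseChangeHom σ).obj S₀)) :=
    (Motives.ComplexPoints.isCoveringMap_map_of_isFinite d ((baseChangeHom σ).map g₀)).1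
  -- Step 4 (base change of the family): `f' : 𝒳 ×_S S' ⟶ S'` is smooth projective, `R^{2p} f'_* ℂ`
  -- is a local system, and `α' = e^* α` is monodromy invariant, hence the value at `s'` of a
  -- continuous global section `σ'`
  have hf' := hf.familyPullback_snd ((baseChangeHom σ).map g₀)
  have hU' := isCohomologicallyLocallyTrivialOn_univ_of_isSmoothProjectiveFamily
    (familyPullback.snd ((baseChangeHom σ).map f₀) ((baseChangeHom σ).map g₀)) d hf' hS'qp
  set e := fiberOverFamilyPullbackIso ((baseChangeHom σ).map f₀) ((baseChangeHom σ).map g₀) s'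
    with he
  have hinv : ∀ γ' : Path (⟨s', Set.mem_univ s'⟩ :
      (Set.univ : Set (ComplexPoints ((baseChangeHom σ).obj S₀')))) ⟨s', Set.mem_univ s'⟩,
      transportFun ((baseChangeHom σ).map f₀) (2 * p) hU
        (s := ⟨AlgPoints.map ((baseChangeHom σ).map g₀) s', Set.mem_univ _⟩)
        (t := ⟨AlgPoints.map ((baseChangeHom σ).map g₀) s', Set.mem_univ _⟩)
        ⟦γ'.map ((((AlgPoints.continuous_map ((baseChangeHom σ).map g₀)).comp
          continuous_subtype_val)).subtype_mk fun _ ↦ Set.mem_univ _)⟧ α = α :=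
    fun γ' ↦ hHfix _ (hloops γ')
  obtain ⟨σ', hσ'c, hσ'pt, hσ'₀⟩ := exists_continuous_section_familyPullback
    ((baseChangeHom σ).map f₀) ((baseChangeHom σ).map g₀) (2 * p) hgloc hU hU' s'
    (complexBetti.map e.hom (2 * p) α) (FiberClass.cls_baseChange_map_hom _ _ _ s' α) hinv
  have h₀ : σ' s' ∈ locusOfHodgeClasses
      (familyPullback.snd ((baseChangeHom σ).map f₀) ((baseChangeHom σ).map g₀)) n p := by
    rw [hσ'₀]
    exact ⟨hαr.map _, hαh.map_of_iso e⟩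
  -- Step 5 (a smooth projective compactification, Hironaka PROVED in the tree)
  set X₀' : SchemeOver (AlgebraicClosure ℚ) := familyPullback f₀ g₀ with hX₀'
  haveI : IsSeparated S₀.hom := isSeparated_hom_of_isQuasiProjectiveOver hS₀
  have hX₀'qp : IsQuasiProjectiveOver X₀' :=
    isQuasiProjectiveOver_familyPullback_of_isSeparated f₀ g₀ h𝒳₀ hS₀'qp
  haveI : AlgebraicGeometry.Smooth ((baseChangeHom σ).map f₀).left := hf.smooth
  haveI : AlgebraicGeometry.Smooth f₀.left := smooth_of_smooth_baseChangeHom_map_left σ f₀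
  haveI : AlgebraicGeometry.Smooth 𝒳₀.hom := by
    rw [← Over.w f₀]
    infer_instance
  haveI : AlgebraicGeometry.Smooth X₀'.hom := by
    change AlgebraicGeometry.Smooth (pullback.fst f₀.left g₀.left ≫ 𝒳₀.hom)
    infer_instance
  haveI : IrreducibleSpace
      (familyPullback ((baseChangeHom σ).map f₀) ((baseChangeHom σ).map g₀)).left :=
    irreducibleSpace_of_isSmoothProjectiveFamily _ hf'
  obtain ⟨eXP, -, -⟩ := exists_familyPullback_iso_baseChangeHom_obj σ f₀ g₀
  set eXP' : (familyPullback ((baseChangeHom σ).map f₀) ((baseChangeHom σ).map g₀)).left ≅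
      ((baseChangeHom σ).obj X₀').left := (Over.forget _).mapIso eXP with heXP'
  haveI : IrreducibleSpace ((baseChangeHom σ).obj X₀').left :=
    (Scheme.homeoOfIso eXP').surjective.irreducibleSpace (Scheme.homeoOfIso eXP').continuous
  haveI : IrreducibleSpace X₀'.left := irreducibleSpace_of_irreducibleSpace_baseChangeHom_obj σ X₀'
  obtain ⟨m, hm⟩ := exists_smoothOfRelativeDimension_of_smooth X₀'.hom
  obtain ⟨Xbar₀, i₀, hXbar₀, hi₀⟩ :=
    exists_isSmoothProjective_isOpenImmersion m X₀' hm hX₀'qp inferInstance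
  haveI := hi₀
  have hXbar : IsSmoothProjective m ((baseChangeHom σ).obj Xbar₀) :=
    IsSmoothProjective.baseChangeHom_holds σ hXbar₀
  set i : familyPullback ((baseChangeHom σ).map f₀) ((baseChangeHom σ).map g₀) ⟶
      (baseChangeHom σ).obj Xbar₀ := eXP.hom ≫ (baseChangeHom σ).map i₀ with hi_def
  haveI hi : IsOpenImmersion i.left := by
    haveI := isOpenImmersion_baseChangeHom_map_left σ i₀
    haveI : IsOpenImmersion eXP.hom.left :=
      (inferInstance : IsOpenImmersion ((Over.forget _).mapIso eXP).hom)
    rw [hi_def, Over.comp_left]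
    infer_instance
  -- Step 6 (global invariant cycles + Hodge lift): a rational `(p,p)` class `β` on `X̄₀ ⊗_σ ℂ`
  -- with `β|_{X'_{s'}} = α' = e^* α`
  obtain ⟨β, -, hβh, hβσ⟩ :=
    hD.exists_hodgeClass_eq_globalSection_of_exists_isReal_hodgeModel exists_isReal_hodgeModel_holds
      hodgePQ_independent_of_hodgeModel_holds smoothProjective_hodgeStructure_isPolarizable_holds _ i
      hf' hS'qp (SmoothOfRelativeDimension.smooth d _) hXbar hi hσ'c hσ'pt h₀
  -- `α' = e^* α` is the restriction of the global class `i^* β` to `X'_{s'}`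
  have hα'eq : complexBetti.map e.hom (2 * p) α =
      complexBetti.map (fiberι (familyPullback.snd ((baseChangeHom σ).map f₀)
        ((baseChangeHom σ).map g₀)) s') (2 * p) (complexBetti.map i (2 * p) β) :=
    (FiberClass.mk_eq_mk_iff _ _).1 (hσ'₀.symm.trans hβσ)
  -- Step 7 (NEW — the conjugates): lift the loop `γ` to a path `γ'` in `S'(ℂ)` from `s'` to `s''`
  obtain ⟨Γ, hΓγ, hΓ0⟩ := hcov.exists_path_lifts
    (γ : C(unitInterval, ComplexPoints ((baseChangeHom σ).obj S₀))) s' γ.source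
  let γ' : Path s' (Γ 1) := { toContinuousMap := Γ, source' := hΓ0, target' := rfl }
  -- upstairs, the restrictions of `i^* β` to `X'_{s'}` and `X'_{s''}` are continuations of each
  -- other along `γ'`; push this continuation down along the base change
  have hup := isContinuationAlong_globalSection
    (familyPullback.snd ((baseChangeHom σ).map f₀) ((baseChangeHom σ).map g₀)) (2 * p)
    (complexBetti.map i (2 * p) β) γ'
  have hdown := IsContinuationAlong.baseChange ((baseChangeHom σ).map f₀) ((baseChangeHom σ).map g₀)
    hU hU' (2 * p) hup
  rw [← hα'eq, ← he, e.complexBetti_map_inv_map_hom] at hdown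
  -- the pushed-down path IS `γ` (as a map), so by uniqueness of continuations `β₁` is the transfer
  -- of `β|_{X'_{s''}}`
  have hcoe : (γ : unitInterval → ComplexPoints ((baseChangeHom σ).obj S₀)) =
      (γ'.map (AlgPoints.continuous_map ((baseChangeHom σ).map g₀)) : unitInterval → _) := by
    rw [Path.map_coe]
    exact hΓγ.symm
  have hfc := linearSystemTorelli_fiberClass_eq_of_isContinuationAlong_of_coe_eq hU γ _ hcoe hβ₁ hdown
  refine (FiberClass.prop_iff_of_mk_eq
    (P := fun t c ↦ IsOfHodgeType n (fiberOver ((baseChangeHom σ).map f₀) t) (2 * p) p p c) hfc).2 ?_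
  -- `β|_{X'_{s''}}` is of type `(p,p)` (pull-back along the algebraic map `X'_{s''} ⟶ X̄`), a type
  -- preserved by the fibre isomorphism
  obtain ⟨B, -⟩ := exists_isReal_hodgeModel_holds n _ (hf'.isSmoothProjective (Γ 1))
  have hζ : IsOfHodgeType n (fiberOver (familyPullback.snd ((baseChangeHom σ).map f₀)
      ((baseChangeHom σ).map g₀)) (Γ 1)) (2 * p) p p
      (complexBetti.map (fiberι (familyPullback.snd ((baseChangeHom σ).map f₀)
        ((baseChangeHom σ).map g₀)) (Γ 1) ≫ i) (2 * p) β) :=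
    hβh.map_of_independent hodgePQ_independent_of_hodgeModel_holds
      (hf'.isSmoothProjective (Γ 1)) hXbar B _
  rw [complexBetti.map_comp, ModuleCat.comp_apply] at hζ
  exact hζ.map_of_iso (fiberOverFamilyPullbackIso ((baseChangeHom σ).map f₀)
    ((baseChangeHom σ).map g₀) (Γ 1)).symm

/-- **Finite monodromy ↔ type stability, pointwise, modulo the two classical debts of line
`IdeatorFiveSketch`.** In the complexification of a smooth projective `ℚ̄`-family over a smooth
irreducible quasi-projective `ℚ̄`-base, for a rational `(p,p)`-class `α` on the fibre over ANY
complex point `s`: the monodromy orbit of `α` (its flat continuations along loops at `s`) is finite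
iff every such continuation is of type `(p,p)` — granted Riemann existence with `ℚ̄`-descent and
Deligne's partie fixe for `→` (`linearSystemTorelli_isOfHodgeType_of_isContinuationAlong_of_finite`);
`←` is UNCONDITIONAL (p127337, `linearSystemTorelli_finite_setOf_isContinuationAlong_of_forall_isOfHodgeType`:
Hodge–Riemann for the relative hyperplane class bounds a lattice orbit). So the line's registered
kernel T (stub A') and the classical "finite monodromy at `ℚ̄`-generic points" are the same statement
inside the line. [cite: Voisin2007HodgeLoci, §3, proof of Prop. 0.7]
[cite: CattaniDeligneKaplan1995, §1] [cite: DeligneHodgeII1971, Théorème 4.1.1] -/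
theorem linearSystemTorelli_finite_setOf_isContinuationAlong_iff_forall_isOfHodgeType
    (hRE : Literature.AlgebraicGeometry.FundamentalGroup.riemannExistence_qbarDescent_of_finiteIndex)
    (hD : deligne_globalInvariantCycles)
    (σ : AlgebraicClosure ℚ →+* ℂ) ⦃𝒳₀ S₀ : SchemeOver (AlgebraicClosure ℚ)⦄ (f₀ : 𝒳₀ ⟶ S₀)
    (n p : ℕ) (h𝒳₀ : IsQuasiProjectiveOver 𝒳₀) (hS₀ : IsQuasiProjectiveOver S₀)
    (hirr : IrreducibleSpace S₀.left) (hsm : AlgebraicGeometry.Smooth S₀.hom)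
    (hf : IsSmoothProjectiveFamily ((baseChangeHom σ).map f₀) n)
    (s : ComplexPoints ((baseChangeHom σ).obj S₀))
    (α : complexBetti (fiberOver ((baseChangeHom σ).map f₀) s) (2 * p)) (hαr : IsRationalClass α)
    (hαh : IsOfHodgeType n (fiberOver ((baseChangeHom σ).map f₀) s) (2 * p) p p α) :
    {β : complexBetti (fiberOver ((baseChangeHom σ).map f₀) s) (2 * p) |
        ∃ γ : Path s s, IsContinuationAlong γ α β}.Finite ↔
      ∀ (γ : Path s s) (β : complexBetti (fiberOver ((baseChangeHom σ).map f₀) s) (2 * p)),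
        IsContinuationAlong γ α β →
          IsOfHodgeType n (fiberOver ((baseChangeHom σ).map f₀) s) (2 * p) p p β :=
  ⟨fun hfin γ β hβ ↦ linearSystemTorelli_isOfHodgeType_of_isContinuationAlong_of_finite hRE hD σ f₀
      n p h𝒳₀ hS₀ hirr hsm hf s α hαr hαh hfin γ β hβ,
    fun hT ↦ linearSystemTorelli_finite_setOf_isContinuationAlong_of_forall_isOfHodgeType σ f₀ n p hf
      h𝒳₀ hS₀ hirr hsm s α hαr hT⟩

/-- **The registered stub A' of line `IdeatorFiveSketch` (T, signature verbatim) from finite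
monodromy, modulo stubs C1 and D.** Type stability of `(2,2)` loop-continuations at `ℚ̄`-generic
points of smooth projective `ℚ̄`-families of fourfolds follows from (i) Riemann's existence theorem
over `ℂ` in covering form (`FundamentalGroup.riemannExistence_finiteCovering`, stub C1, SGA1 XII 5.1 —
fed through `riemannExistence_qbarDescent_of_finiteIndex_of_riemannExistence_finiteCovering`,
p126127, which supplies the `ℚ̄`-descent), (ii) Deligne's global invariant cycle theorem as the
route decl `Theses.LinearSystemTorelli.DeligneGlobalInvariantCycles` (stub D = stmt-16363, `Iff.rfl`
with the named fact), and (iii) the ∀-form of the old stub A: at every point over the generic point,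
every rational `(2,2)`-class has finite monodromy orbit. Together with p127337 (A ⟸ A'
unconditionally) this is the kernel-checked statement that the reshape v9 → v10 of the skeleton
(A ↦ A') lost nothing modulo the line's own debts C1, D. [cite: Voisin2007HodgeLoci, §3, proof of Prop. 0.7]
[cite: DeligneHodgeII1971, Théorème 4.1.1] [cite: SGA1, Exp. XII Thm. 5.1] -/
theorem linearSystemTorelli_typeStabilityAtQbarGeneric_of_forall_finite :
    Literature.AlgebraicGeometry.FundamentalGroup.riemannExistence_finiteCovering →
    Theses.LinearSystemTorelli.DeligneGlobalInvariantCycles → (∀ (σ : AlgebraicClosure ℚ →+* ℂ) ⦃𝒳₀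
    S₀ : SchemeOver (AlgebraicClosure ℚ)⦄ (f₀ : 𝒳₀ ⟶ S₀), IsQuasiProjectiveOver 𝒳₀ →
    IsQuasiProjectiveOver S₀ → IrreducibleSpace S₀.left → AlgebraicGeometry.Smooth S₀.hom →
    IsSmoothProjectiveFamily ((baseChangeHom σ).map f₀) 4 → ∀ (s : ComplexPoints ((baseChangeHom
    σ).obj S₀)), closure {(baseChangeHomFst σ S₀).base s.pt} = (Set.univ : Set S₀.left) → ∀ (α :
    complexBetti (fiberOver ((baseChangeHom σ).map f₀) s) 4), IsRationalClass α → IsOfHodgeType 4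
    (fiberOver ((baseChangeHom σ).map f₀) s) 4 2 2 α → {β : complexBetti (fiberOver ((baseChangeHom
    σ).map f₀) s) 4 | ∃ γ : Path s s, IsContinuationAlong γ α β}.Finite) → ∀ (σ : AlgebraicClosure ℚ
    →+* ℂ) ⦃𝒳₀ S₀ : SchemeOver (AlgebraicClosure ℚ)⦄ (f₀ : 𝒳₀ ⟶ S₀), IsQuasiProjectiveOver 𝒳₀ →
    IsQuasiProjectiveOver S₀ → IrreducibleSpace S₀.left → AlgebraicGeometry.Smooth S₀.hom →
    IsSmoothProjectiveFamily ((baseChangeHom σ).map f₀) 4 → ∀ (s : ComplexPoints ((baseChangeHom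
    σ).obj S₀)), closure {(baseChangeHomFst σ S₀).base s.pt} = (Set.univ : Set S₀.left) → ∀ (α :
    complexBetti (fiberOver ((baseChangeHom σ).map f₀) s) 4), IsRationalClass α → IsOfHodgeType 4
    (fiberOver ((baseChangeHom σ).map f₀) s) 4 2 2 α → ∀ (γ : Path s s) (β : complexBetti (fiberOver
    ((baseChangeHom σ).map f₀) s) 4), IsContinuationAlong γ α β → IsOfHodgeType 4 (fiberOver
    ((baseChangeHom σ).map f₀) s) 4 2 2 β := by
  intro hC1 hD hA σ 𝒳₀ S₀ f₀ h𝒳₀ hS₀ hirr hsm hf s hgen α hαr hαh γ β hβ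
  exact linearSystemTorelli_isOfHodgeType_of_isContinuationAlong_of_finite
    (Literature.AlgebraicGeometry.FundamentalGroup.riemannExistence_qbarDescent_of_finiteIndex_of_riemannExistence_finiteCovering
      hC1)
    hD σ f₀ 4 2 h𝒳₀ hS₀ hirr hsm hf s α hαr hαh (hA σ f₀ h𝒳₀ hS₀ hirr hsm hf s hgen α hαr hαh) γ β hβ

end Summit.HodgeConjecture.HodgeConjecture.Theorems

end
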